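/-
Origin: expansion seat `planner-pub-hodgecm-toy-g2-0`, handover #33 2026-08-18T10:13:52Z (`HOME/pub-hodgecm-toy-g2/lean/ToyG2/RadicalProdStep.lean`, md5 9d13c935, 234 lines);
landed by the gen-7 packager in gate run 28 as `HodgeCM/Model/ToyG2/RadicalProdStep.lean` (import ^import ToyG2\.→import HodgeCM.Model.ToyG2. ×1).
-/
/-
# HodgeCM.Model.ToyG2.RadicalProdStep — the product step `GenProdStep` (G1 for all good objects)

Generation 2 of the `pub-hodgecm-toy` lineage (seat `planner-pub-hodgecm-toy-g2-0`), DESIGN.md §9·UPDATE 10:15Z, GEN-3 ITEM 1 completed: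
**`genProdStep : GenProdStep`** — radical killing passes to binary products of good objects.  With `RadicalProd` this gives
`genRadKilled_of_good : X.Good → GenRadKilled S X` for every good surface `S`, hence `RadKilled` (G1, the rational Gysin classes) for ALL
good targets, and `ModelAxioms` for `toyUniverse₃ d t` from the single remaining statement `HRProdStep`
(**`toyUniverse₃_modelAxioms_of_hrProdStep`**).

Proof: the bidegree grouping `exists_bidegree_repr` (every class in `⋀^n H¹(X × Y)` is a sum over `d` of Künneth images of tensors in
`⋀^d H¹X ⊗ ⋀^{n-d} H¹Y`, from `span_ιMulti_mixed` / `exists_perm_eq_append_of_mixedAlong`), the evaluation `trOf_wedge_liftkun_kun` of the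
Künneth trace on (tensor) ⊠ (pure) which isolates one group, and `prodStep_group` (the tensor radical lemma) per group; groups whose bidegree has
no complement vanish because a factor exterior power is zero (`subsingleton_extPow_of_sdeg_lt`).
-/
import Mathlib
import Summits.HodgeConjecture.HodgeCM.Model.ToyG2.ProdStepPrep

namespace HodgeCM.ToyG2

open HodgeCM.Toy HodgeCM.Toy.CMPresentation
open Literature.AlgebraicGeometry.Motives
open scoped TensorProduct
open exteriorPower Obj₂

noncomputable section

/-! ### small tools -/

/-- transport of an exterior class along an equality of degrees (the underlying element of the exterior algebra is unchanged) -/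
def powCast {M : Type*} [AddCommGroup M] [Module ℚ M] {a b : ℕ} (h : a = b) (x : ⋀[ℚ]^a M) : ⋀[ℚ]^b M :=
  ⟨x, by subst h; exact x.2⟩

/-- (Ported verbatim from the HodgeCMPerL package; no docstring in the source.) -/
@[simp] lemma coe_powCast {M : Type*} [AddCommGroup M] [Module ℚ M] {a b : ℕ} (h : a = b) (x : ⋀[ℚ]^a M) :
    ((powCast h x : ⋀[ℚ]^b M) : ExteriorAlgebra ℚ M) = x := rfl

/-- (Ported verbatim from the HodgeCMPerL package; no docstring in the source.) -/
lemma tensor_eq_zero_of_subsingleton_left {M N : Type*} [AddCommGroup M] [Module ℚ M] [AddCommGroup N] [Module ℚ N]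
    [Subsingleton M] (x : M ⊗[ℚ] N) : x = 0 := by
  induction x using TensorProduct.induction_on with
  | zero => rfl
  | tmul a b => rw [Subsingleton.elim a 0, TensorProduct.zero_tmul]
  | add a b ha hb => rw [ha, hb, add_zero]

/-- (Ported verbatim from the HodgeCMPerL package; no docstring in the source.) -/
lemma tensor_eq_zero_of_subsingleton_right {M N : Type*} [AddCommGroup M] [Module ℚ M] [AddCommGroup N] [Module ℚ N]
    [Subsingleton N] (x : M ⊗[ℚ] N) : x = 0 := by
  induction x using TensorProduct.induction_on with
  | zero => rfl
  | tmul a b => rw [Subsingleton.elim b 0, TensorProduct.tmul_zero]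
  | add a b ha hb => rw [ha, hb, add_zero]

/-- in degrees `d ≤ 4` beyond `sdeg X` the exterior power vanishes (such an `X` is block-free of rank `sdeg X`) -/
theorem subsingleton_extPow_of_sdeg_lt (X : Obj₂) {d : ℕ} (hd4 : d ≤ 4) (h : sdeg X.s X.leaf < d) :
    Subsingleton (⋀[ℚ]^d X.L) := by
  have hbf : X.IsBlockFree := fun u hu => by
    have := four_le_sdeg_of_isPB X.s X.leaf u hu
    omega
  have hr : Module.finrank ℚ X.L < d := by
    rw [← two_mul_dim_eq_finrank hbf, ← sdeg_eq]
    exact h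
  exact subsingleton_extPow_of_finrank_lt hr

/-! ### the Künneth trace on (tensor) ⊠ (pure) -/

/-- (Ported verbatim from the HodgeCMPerL package; no docstring in the source.) -/
theorem trOf_wedge_liftkun_kun (X Y : Obj₂) {i j p q : ℕ} (t : (⋀[ℚ]^i X.L) ⊗[ℚ] (⋀[ℚ]^j Y.L))
    (c : ⋀[ℚ]^p X.L) (d : ⋀[ℚ]^q Y.L) :
    trOf (X.prod Y) ((i + j) + (p + q))
        (wedge ℚ (X.prod Y).L (i + j) (p + q) (TensorProduct.lift (kun X Y i j) t) (kun X Y p q c d))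
      = (-1 : ℚ) ^ (j * p) *
        (if sdeg X.s X.leaf = i + p ∧ sdeg Y.s Y.leaf = j + q
          then TensorProduct.lift (mulForm ((trPairing X i p).flip c) ((trPairing Y j q).flip d)) t else 0) := by
  induction t using TensorProduct.induction_on with
  | zero =>
    simp only [map_zero, LinearMap.zero_apply]
    split_ifs <;> simp
  | tmul a b =>
    rw [TensorProduct.lift.tmul, TensorProduct.lift.tmul, trOf_wedge_kun_kun, mulForm_apply]
    rfl
  | add x y hx hy =>
    simp only [map_add, LinearMap.add_apply, hx, hy]
    split_ifs <;> ring

/-! ### the bidegree grouping -/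

/-- a mixed pure wedge is a Künneth product -/
theorem exists_kun_eq_ιMulti (X Y : Obj₂) {n d : ℕ} (w : Fin n → (X.prod Y).L) (T : Finset (Fin n))
    (hw : MixedAlong X Y w T) (hT : T.card = d) :
    ∃ (m : ℕ) (_ : d + m = n) (a : ⋀[ℚ]^d X.L) (b : ⋀[ℚ]^m Y.L),
      ((ιMulti ℚ n w : ⋀[ℚ]^n (X.prod Y).L) : ExteriorAlgebra ℚ (X.prod Y).L)
        = ((kun X Y d m a b : ⋀[ℚ]^(d + m) (X.prod Y).L) : ExteriorAlgebra ℚ (X.prod Y).L) := by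
  have hd : d ≤ n := by
    rw [← hT]
    exact (Finset.card_le_univ T).trans (by rw [Fintype.card_fin])
  obtain ⟨m, rfl⟩ : ∃ m, n = d + m := ⟨n - d, by omega⟩
  obtain ⟨σ, x, y, h⟩ := exists_perm_eq_append_of_mixedAlong X Y w T hw hT
  refine ⟨m, rfl, ((Equiv.Perm.sign σ : ℤ) : ℚ) • ιMulti ℚ d x, ιMulti ℚ m y, ?_⟩
  have hperm : ιMulti ℚ (d + m) w = Equiv.Perm.sign σ • ιMulti ℚ (d + m) (w ∘ σ) := by
    rw [AlternatingMap.map_perm, smul_smul, Int.units_mul_self, one_smul]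
  rw [hperm, Units.smul_def, h, ← kun_ιMulti, map_smul, LinearMap.smul_apply, Int.cast_smul_eq_zsmul]

set_option maxHeartbeats 1200000 in
/-- **bidegree grouping**: every class in `⋀^n H¹(X × Y)` is `Σ_d (Künneth image of a tensor in ⋀^d H¹X ⊗ ⋀^{n-d} H¹Y)` -/
theorem exists_bidegree_repr (X Y : Obj₂) (n : ℕ) (y : ⋀[ℚ]^n (X.prod Y).L) :
    ∃ t : (d : Fin (n + 1)) → (⋀[ℚ]^(d : ℕ) X.L) ⊗[ℚ] (⋀[ℚ]^(n - d) Y.L),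
      (y : ExteriorAlgebra ℚ (X.prod Y).L)
        = ∑ d : Fin (n + 1), ((TensorProduct.lift (kun X Y (d : ℕ) (n - d)) (t d) : ⋀[ℚ]^((d : ℕ) + (n - d)) (X.prod Y).L)
            : ExteriorAlgebra ℚ (X.prod Y).L) := by
  classical
  have hy : y ∈ Submodule.span ℚ {z : ⋀[ℚ]^n (X.prod Y).L |
      ∃ (w : Fin n → (X.prod Y).L) (T : Finset (Fin n)), MixedAlong X Y w T ∧ z = ιMulti ℚ n w} := by
    rw [span_ιMulti_mixed]
    trivial
  induction hy using Submodule.span_induction with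
  | mem z hz =>
    obtain ⟨w, T, hw, rfl⟩ := hz
    obtain ⟨m, hm, a, b, hab⟩ := exists_kun_eq_ιMulti X Y w T hw rfl
    obtain ⟨d₀, hd₀⟩ : ∃ d₀ : Fin (n + 1), (d₀ : ℕ) = T.card := ⟨⟨T.card, by omega⟩, rfl⟩
    have hmd : m = n - d₀ := by omega
    refine ⟨Pi.single d₀ (powCast hd₀.symm a ⊗ₜ powCast hmd b), ?_⟩
    rw [Finset.sum_eq_single d₀, Pi.single_eq_same, TensorProduct.lift.tmul, hab]
    · simp only [kun_apply, wedge_coe, coe_map, coe_powCast]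
    · intro d _ hd
      rw [Pi.single_eq_of_ne hd, map_zero, ZeroMemClass.coe_zero]
    · intro h
      exact absurd (Finset.mem_univ _) h
  | zero =>
    exact ⟨fun _ => 0, by simp only [map_zero, ZeroMemClass.coe_zero, Finset.sum_const_zero]⟩
  | add x x' _ _ hx hx' =>
    obtain ⟨t, ht⟩ := hx
    obtain ⟨t', ht'⟩ := hx'
    refine ⟨t + t', ?_⟩
    rw [Submodule.coe_add, ht, ht', ← Finset.sum_add_distrib]
    refine Finset.sum_congr rfl fun d _ => ?_
    rw [Pi.add_apply, map_add, Submodule.coe_add]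
  | smul c x _ hx =>
    obtain ⟨t, ht⟩ := hx
    refine ⟨c • t, ?_⟩
    rw [Submodule.coe_smul, ht, Finset.smul_sum]
    refine Finset.sum_congr rfl fun d _ => ?_
    rw [Pi.smul_apply, map_smul, Submodule.coe_smul]

/-! ### the product step -/

/-- **G1 product step**: radical killing passes to binary products of good objects -/
theorem genProdStep : GenProdStep := by
  intro S X₁ X₂ _ hS2 _ _ G₁ G₂ i j hij ψ hψ k z y hy
  have h4S : sdeg S.s S.leaf = 4 := by rw [sdeg_eq, hS2]
  by_cases hik : i + k = 4
  swap
  · rw [trOf_of_ne (by rw [h4S]; omega), LinearMap.zero_apply]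
  have hmn : sdeg (X₁.prod X₂).s (X₁.prod X₂).leaf = sdeg X₁.s X₁.leaf + sdeg X₂.s X₂.leaf := rfl
  rw [hmn] at hij
  -- bidegree grouping of `y`
  obtain ⟨t, ht⟩ := exists_bidegree_repr X₁ X₂ i y
  have e : ∀ d : Fin (i + 1), (d : ℕ) + (i - d) = i := fun d => by have := d.2; omega
  obtain ⟨yd, hyd⟩ : ∃ yd : Fin (i + 1) → ⋀[ℚ]^i (X₁.prod X₂).L, ∀ d,
      (yd d : ExteriorAlgebra ℚ (X₁.prod X₂).L)
        = (TensorProduct.lift (kun X₁ X₂ (d : ℕ) (i - d)) (t d) : ⋀[ℚ]^((d : ℕ) + (i - d)) (X₁.prod X₂).L) :=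
    ⟨fun d => powCast (e d) (TensorProduct.lift (kun X₁ X₂ (d : ℕ) (i - d)) (t d)), fun d => rfl⟩
  have hy' : y = ∑ d : Fin (i + 1), yd d := by
    apply Subtype.ext
    rw [ht, Submodule.coe_sum]
    exact Finset.sum_congr rfl fun d _ => (hyd d).symm
  -- the functional on each group
  have hval : ∀ d : Fin (i + 1), trOf S (i + k) (wedge ℚ S.L i k (map i ψ (yd d)) z)
      = TensorProduct.lift (prodF S X₁ X₂ ψ (d : ℕ) (i - d) k z) (t d) := by
    intro d
    rw [← trOf_map_lift_kun]
    exact trOf_congr S (by rw [e d]) (by simp only [wedge_coe, coe_map, hyd])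
  -- each group vanishes
  have hzero : ∀ d : Fin (i + 1), trOf S (i + k) (wedge ℚ S.L i k (map i ψ (yd d)) z) = 0 := by
    intro d
    have hdi : (d : ℕ) ≤ i := by have := d.2; omega
    rw [hval d]
    by_cases hd : (d : ℕ) ≤ sdeg X₁.s X₁.leaf ∧ i - d ≤ sdeg X₂.s X₂.leaf
    · -- a group with a complementary bidegree: the tensor radical lemma
      have hj₁ : (d : ℕ) + (sdeg X₁.s X₁.leaf - d) = sdeg X₁.s X₁.leaf := by omega
      have hj₂ : (i - d) + (sdeg X₂.s X₂.leaf - (i - d)) = sdeg X₂.s X₂.leaf := by omega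
      rw [← trOf_map_lift_kun]
      refine prodStep_group G₁ G₂ hψ hj₁ hj₂ (t d) fun w₁ w₂ => ?_
      have ej : (sdeg X₁.s X₁.leaf - d) + (sdeg X₂.s X₂.leaf - (i - d)) = j := by omega
      have h0 := (mem_leftRad.1 hy) (powCast ej (kun X₁ X₂ _ _ w₁ w₂))
      rw [hy', map_sum, LinearMap.sum_apply, map_sum] at h0
      have key : ∀ d' : Fin (i + 1),
          trOf (X₁.prod X₂) (i + j) (wedge ℚ (X₁.prod X₂).L i j (yd d') (powCast ej (kun X₁ X₂ _ _ w₁ w₂)))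
            = (-1 : ℚ) ^ ((i - d') * (sdeg X₁.s X₁.leaf - d)) *
              (if sdeg X₁.s X₁.leaf = d' + (sdeg X₁.s X₁.leaf - d) ∧
                  sdeg X₂.s X₂.leaf = (i - d') + (sdeg X₂.s X₂.leaf - (i - d))
                then TensorProduct.lift (mulForm ((trPairing X₁ d' (sdeg X₁.s X₁.leaf - d)).flip w₁)
                  ((trPairing X₂ (i - d') (sdeg X₂.s X₂.leaf - (i - d))).flip w₂)) (t d') else 0) := by
        intro d'
        exact (trOf_congr (X₁.prod X₂) (by rw [e d', ej]) (by simp only [wedge_coe, hyd, coe_powCast])).trans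
          (trOf_wedge_liftkun_kun X₁ X₂ (t d') w₁ w₂)
      simp only [key] at h0
      rw [Finset.sum_eq_single d (fun d' _ hd' => by
          rw [if_neg, mul_zero]
          rintro ⟨h1, -⟩
          exact hd' (Fin.ext (by omega)))
        (fun h => absurd (Finset.mem_univ _) h)] at h0
      have hc : sdeg X₁.s X₁.leaf = d + (sdeg X₁.s X₁.leaf - d) ∧
          sdeg X₂.s X₂.leaf = (i - d) + (sdeg X₂.s X₂.leaf - (i - d)) := ⟨by omega, by omega⟩
      rw [if_pos hc] at h0
      exact (mul_eq_zero.1 h0).resolve_left (pow_ne_zero _ (by norm_num))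
    · -- no complementary bidegree: a factor exterior power is zero, so the tensor is zero
      have ht0 : t d = 0 := by
        rcases not_and_or.1 hd with h1 | h1
        · haveI := subsingleton_extPow_of_sdeg_lt X₁ (show (d : ℕ) ≤ 4 by omega) (not_le.1 h1)
          exact tensor_eq_zero_of_subsingleton_left (t d)
        · haveI := subsingleton_extPow_of_sdeg_lt X₂ (show i - d ≤ 4 by omega) (not_le.1 h1)
          exact tensor_eq_zero_of_subsingleton_right (t d)
      rw [ht0, map_zero]
  -- sum up
  rw [hy', map_sum, map_sum, LinearMap.sum_apply, map_sum]
  exact Finset.sum_eq_zero fun d _ => hzero d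

/-! ### consequences -/

/-- G1 for every good target: `GenRadKilled S X` (hence `RadKilled`, i.e. rational Gysin classes) for all good `S` with `dim S = 2` and all good `X` -/
theorem genRadKilled_of_good {S X : Obj₂} (hS : S.Good) (hS2 : S.dim = 2) (hX : X.Good) : GenRadKilled S X :=
  genRadKilled_of_steps genBlockStep genProdStep hS hS2 X.s X.leaf hX

/-- (Ported verbatim from the HodgeCMPerL package; no docstring in the source.) -/
theorem radKilled_of_good {S X : Obj₂} (hS : S.Good) (hS2 : S.dim = 2) (hX : X.Good) (f : Hom₂ S X) : RadKilled S X f :=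
  radKilled_of_genRadKilled (genRadKilled_of_good hS hS2 hX) f

/-- **`ModelAxioms` for `toyUniverse₃ d t` from the single remaining statement `HRProdStep`** -/
theorem toyUniverse₃_modelAxioms_of_hrProdStep (d t : ℚ) (h : HRProdStep) : (toyUniverse₃ d t).ModelAxioms :=
  toyUniverse₃_modelAxioms_of_prodSteps d t genProdStep h

/-- and from Hodge–Riesz for good objects directly -/
theorem toyUniverse₃_modelAxioms_of_hodgeRiesz (d t : ℚ) (h2 : ∀ X : Obj₂, X.Good → HodgeRiesz X) :
    (toyUniverse₃ d t).ModelAxioms :=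
  toyUniverse₃_modelAxioms_of_prodStep d t genProdStep h2

end

end HodgeCM.ToyG2
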